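import Literature.Geometry.Kaehler.HolomorphicChainBoundaryRegular
import Literature.Geometry.GeometricMeasureTheory.LevelSetChartCurrent
import Literature.Analysis.Calculus.SardProofs
import HarnessLib

/-!
# Level slices of a holomorphic chain near its regular points

A brick of the proof of King's tangent cone theorem without the boundary rectifiability theorem
(`Literature.Geometry.Kaehler.King1971_tangentCone`; [Harvey1977, Thm. 1.31], [Federer1969,
4.3.16]): the boundary of a holomorphic chain cut by a superlevel set `{s < f}` of a smooth
function is, near the REGULAR points of the chain and for almost every level `s`, the current of
integration over the level manifold `reg|T| ∩ f⁻¹{s}` — Federer's slicing formula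
`∂(T ⌞ {s < f}) = ⟨T, f, s+⟩ = (𝓗^{m-1} ⌞ W ∩ f⁻¹{s}) ∧ ζ` [Federer1969, 4.3.8] for the smooth
submanifold `reg|T|`, obtained here by Gauss–Green in a straightened holomorphic chart (Harvey's
"of course, `dT = 0` on `Ω - Sing V`" computation [Harvey1977, proof of Lemma 1.8], one dimension
down).

Let `T` be a holomorphic `p`-chain on `Ω ⊆ V` (`p = q + 1`), `f : V → ℝ` smooth and
`x₀ ∈ reg|T|`. In the straightened chart `Ψ₀ : B = ball 0 ρ ⊆ K → |T| ∩ N` at `x₀` of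
`HolomorphicChainBoundaryRegular.lean` (`θ_T = k₀` a.e. on the chart, `ξ_T ∘ Ψ₀` the real frame of
a unitary frame of `im DΨ₀`), transported to `ℝ^{2p}` by the real frame `Eb` of a unitary basis of
`K`:

* `HolomorphicChain.boundary_currentOfIntegration_inter_apply` — the formula
  `∂[reg|T| ∩ E, θ_T, ξ_T](φ) = ∫_{reg|T| ∩ E} θ_T dφ(ξ_T) d𝓗^{2p}` on every open `U ≤ Ω` (Lelong:
  the density is locally summable);
* `HolomorphicChain.exists_nhds_sliceData` — **the slice near a regular point**: there are an open
  `N ∋ x₀` and a Lebesgue-null set `Bad ⊆ ℝ` of levels (the critical values of `f ∘ Ψ₀`, Sard's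
  theorem `Literature.Analysis.Calculus.measure_image_setOf_not_surjective_fderiv_eq_zero`) such
  that for `s ∉ Bad` every `x ∈ reg|T| ∩ N` with `f x = s` has an open neighbourhood `O` and
  admissible rectifiable data `(reg|T| ∩ f⁻¹{s} ∩ O, θ, ν)` on `Ω` with
  `∂[reg|T| ∩ {s < f}, θ_T, ξ_T](φ) = [reg|T| ∩ f⁻¹{s} ∩ O, θ, ν](φ)` for all test forms `φ`
  supported in `O`, on every open `U ≤ Ω`: the chain of identities of
  `HolomorphicChain.exists_nhds_boundary_apply_eq_zero` (localisation, constancy of the density,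
  area formula `Literature.Analysis.Calculus.integral_image_eq_integral_normDet_smul`, canonical
  orientation `apply_comp_complexFrame_eq_normDet_mul`) ends with
  `k₀ ∫_{O₁ ∩ {s < f ∘ Ψ}} (Ψ^* dφ)(e) dx`, which is the level-set current of the chart
  (`Literature.Geometry.GeometricMeasureTheory.exists_levelSet_chartData`);
* `HolomorphicChain.ae_forall_exists_sliceData` — hence (Lindelöf) for almost every level `s`,
  EVERY point of `reg|T| ∩ f⁻¹{s}` has such a neighbourhood.

Also two bookkeeping lemmas on currents of integration with a density scaled by an integer
(`currentOfIntegration_const_mul_apply`, `IsRectifiableData.const_mul`).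
Theorems only; no definitions, no named facts.

## References

* H. Federer, *Geometric Measure Theory*, Springer 1969, 4.3.8, 4.1.28, 3.2.3 [Federer1969].
* R. Harvey, *Holomorphic chains and their boundaries*, PSPUM XXX.1 (1977), Lemma 1.8 (p. 320)
  [Harvey1977].
* A. Sard, *The measure of the critical values of differentiable maps*, Bull. AMS 48 (1942),
  Thm. 4.1 [Sard1942].
-/

open scoped Manifold Topology ContDiff ENNReal NNReal
open Set Filter MeasureTheory Metric Function TopologicalSpace WithLp

/-! ### Scaling the density of a current of integration -/

namespace Literature.Geometry.GeometricMeasureTheory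

-- Nested operator-norm instances on `Multivector V m`.
set_option maxSynthPendingDepth 2

section ConstMul

variable {V : Type*} [NormedAddCommGroup V] [InnerProductSpace ℝ V] [MeasurableSpace V]
  [BorelSpace V] {Ω : Opens V} {m : ℕ}

omit [MeasurableSpace V] [BorelSpace V] in
/-- `c θ ξ₁ ∧ ⋯ ∧ ξₘ = c • (θ ξ₁ ∧ ⋯ ∧ ξₘ)` as density fields. [cite: Federer1969, 4.1.28 (4)] -/
private theorem intCast_mul_smul_frameVector_eq (θ : V → ℤ) (ξ : V → Fin m → V) (c : ℤ) :
    (fun x => ((c * θ x : ℤ) : ℝ) • frameVector (ξ x)) =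
      (c : ℝ) • fun x => (θ x : ℝ) • frameVector (ξ x) := by
  funext x
  rw [Pi.smul_apply, smul_smul, Int.cast_mul]

/-- **`[W, c θ, ξ](φ) = c · [W, θ, ξ](φ)`** for locally summable data `(W, θ, ξ)` and `c ∈ ℤ`.
[cite: Federer1969, 4.1.28 (4) with 4.1.7] -/
theorem currentOfIntegration_const_mul_apply {W : Set V} {θ : V → ℤ} {ξ : V → Fin m → V}
    (h : LocallyIntegrableOn (fun x => (θ x : ℝ) • frameVector (ξ x)) (Ω : Set V)
      ((μHE[m] : Measure V).restrict W)) (c : ℤ) (φ : TestForm Ω m) :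
    (currentOfIntegration W (fun x => c * θ x) ξ : Current Ω m) φ =
      (c : ℝ) * currentOfIntegration W θ ξ φ := by
  have h' : LocallyIntegrableOn (fun x => ((c * θ x : ℤ) : ℝ) • frameVector (ξ x)) (Ω : Set V)
      ((μHE[m] : Measure V).restrict W) := by
    rw [intCast_mul_smul_frameVector_eq]
    exact h.smul (c : ℝ)
  rw [currentOfIntegration_apply h', currentOfIntegration_apply h, ← integral_const_mul]
  congr 1
  funext x
  rw [Int.cast_mul, mul_assoc]

/-- **Admissible data stay admissible under `θ ↦ c θ`** (`c ∈ ℤ`). [cite: Federer1969, 4.1.28 (4)] -/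
theorem IsRectifiableData.const_mul {W : Set V} {θ : V → ℤ} {ξ : V → Fin m → V}
    (h : IsRectifiableData Ω m W θ ξ) (c : ℤ) : IsRectifiableData Ω m W (fun x => c * θ x) ξ := by
  obtain ⟨h1, h2, h3, h4, h5⟩ := h
  refine ⟨h1, h2, h3, ?_, h5⟩
  rw [intCast_mul_smul_frameVector_eq]
  exact h4.smul (c : ℝ)

end ConstMul

end Literature.Geometry.GeometricMeasureTheory

namespace Literature.Geometry.Kaehler

namespace HolomorphicChain

open Literature.Geometry.GeometricMeasureTheory

-- Nested operator-norm instances on `Covector V m`, as in `Currents.lean`.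
set_option maxSynthPendingDepth 2

variable {V : Type*} [NormedAddCommGroup V] [InnerProductSpace ℂ V] [FiniteDimensional ℂ V]
  [MeasurableSpace V] [BorelSpace V] {Ω : Opens V}

/-! ### The boundary of a cut-down chain as an integral -/

/-- **`∂[reg|T| ∩ E, θ_T, ξ_T](φ) = ∫_{reg|T| ∩ E} θ_T · dφ(ξ_T) d𝓗^{2q+2}`** on every open
`U ≤ Ω`, for a holomorphic `(q+1)`-chain `T` on `Ω` and any set `E`: the integral formula for the
current of integration holds because the density of `[T]` is locally summable on `Ω` by Lelong's
theorem (`locallyIntegrableOn_of_lelong`), hence on `U`, hence so is its restriction to `E`.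
[cite: Harvey1977, Lemma 1.3 and §1.3; Federer1969, 4.1.7] -/
theorem boundary_currentOfIntegration_inter_apply {q : ℕ} (T : HolomorphicChain 𝓘(ℂ, V) Ω (q + 1))
    {U : Opens V} (hU : U ≤ Ω) (E : Set V) (φ : TestForm U (2 * q + 1)) :
    letI : InnerProductSpace ℝ V := InnerProductSpace.complexToReal
    (currentOfIntegration (T.carrier ∩ E) T.density
        (T.orientationFrame : V → Fin (2 * q + 1 + 1) → V) : Current U (2 * q + 1 + 1)).boundary φ =
      ∫ y in T.carrier ∩ E, (T.density y : ℝ) * (extDeriv ⇑φ y) (T.orientationFrame y)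
        ∂(μHE[2 * q + 1 + 1] : Measure V) := by
  letI : InnerProductSpace ℝ V := InnerProductSpace.complexToReal
  have hli : LocallyIntegrableOn
      (fun x => (T.density x : ℝ) • frameVector (T.orientationFrame x : Fin (2 * q + 1 + 1) → V))
      (U : Set V) ((μHE[2 * q + 1 + 1] : Measure V).restrict (T.carrier ∩ E)) := by
    have h := (T.locallyIntegrableOn_of_lelong Lelong1957_hausdorffMeasure_inter_lt_top_holds).mono_set
      (show (U : Set V) ⊆ Ω from hU)
    intro x hx
    obtain ⟨u, hu, hu'⟩ := h x hx
    exact ⟨u, hu, hu'.mono_measure (Measure.restrict_mono inter_subset_left le_rfl)⟩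
  rw [Current.boundary_apply, currentOfIntegration_apply hli, TestForm.extDerivCLM_apply]
  rfl

/-! ### The slice near a regular point -/

open Literature.Analysis.Calculus in
/-- **Level slices of a holomorphic chain near a regular point.** Let `T` be a holomorphic
`(q+1)`-chain on `Ω`, `f : V → ℝ` smooth and `x₀ ∈ reg|T|`. There are an open `N ∋ x₀` (the domain
of a straightened chart `Ψ₀ : B → |T| ∩ N`) and a Lebesgue-null set `Bad` of levels (the critical
values of `f ∘ Ψ₀`; Sard) such that for every level `s ∉ Bad` and every `x ∈ reg|T| ∩ N` with
`f x = s` there are an open `O ∋ x` and admissible rectifiable data `(reg|T| ∩ f⁻¹{s} ∩ O, θ, ν)`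
on `Ω` with
`∂[reg|T| ∩ {s < f}, θ_T, ξ_T](φ) = [reg|T| ∩ f⁻¹{s} ∩ O, θ, ν](φ)`
for all test forms `φ` supported in `O`, on every open `U ≤ Ω`. Computation, for such `φ`:
`∂[reg|T| ∩ {s<f}](φ) = ∫_{reg|T| ∩ N ∩ {s<f}} θ_T dφ(ξ_T) d𝓗^{2q+2}` (Lelong; `dφ = 0` off `N`)
`= k₀ ∫_{B ∩ {s < f∘Ψ₀}} J(DΨ₀) dφ(ξ_T ∘ Ψ₀) dk` (`θ_T = k₀` a.e. on the chart; area formula)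
`= k₀ ∫_{B ∩ {s < f∘Ψ₀}} (Ψ₀^* dφ)(e) dk` (canonical orientation) `= k₀ ∫_{O₁ ∩ {s < G}} (Ψ^* dφ)(e₀,…)`
(`Ψ = Ψ₀ ∘ Eb`, `Eb` the real frame of a unitary basis of `K`, an isometry `ℝ^{2q+2} ≅ K`)
`= k₀ [Ψ(O₁ ∩ G⁻¹{s}), θ', ν](φ)` (the level-set current of the chart at the regular level `s`,
`exists_levelSet_chartData`). [cite: Federer1969, 4.3.8; Harvey1977, Lemma 1.8 (proof, p. 320);
Sard1942, Thm. 4.1] -/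
theorem exists_nhds_sliceData {q : ℕ} (T : HolomorphicChain 𝓘(ℂ, V) Ω (q + 1)) {f : V → ℝ}
    (hf : ContDiff ℝ ∞ f) {x₀ : V} (hx₀ : x₀ ∈ T.carrier) :
    letI : InnerProductSpace ℝ V := InnerProductSpace.complexToReal
    ∃ N : Set V, IsOpen N ∧ x₀ ∈ N ∧ ∃ Bad : Set ℝ, volume Bad = 0 ∧
      ∀ s ∉ Bad, ∀ x ∈ T.carrier ∩ N, f x = s →
        ∃ O : Set V, IsOpen O ∧ x ∈ O ∧ ∃ (θ : V → ℤ) (ν : V → Fin (2 * q + 1) → V),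
          IsRectifiableData Ω (2 * q + 1) (T.carrier ∩ f ⁻¹' {s} ∩ O) θ ν ∧
          ∀ U : Opens V, U ≤ Ω → ∀ φ : TestForm U (2 * q + 1), tsupport ⇑φ ⊆ O →
            (currentOfIntegration (T.carrier ∩ {y | s < f y}) T.density
                (T.orientationFrame : V → Fin (2 * q + 1 + 1) → V) :
                  Current U (2 * q + 1 + 1)).boundary φ =
              currentOfIntegration (T.carrier ∩ f ⁻¹' {s} ∩ O) θ ν φ := by
  classical
  letI iV : InnerProductSpace ℝ V := InnerProductSpace.complexToReal
  haveI : ProperSpace V := FiniteDimensional.proper ℂ V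
  set n := Module.finrank ℂ V with hn
  set Z : Set V := ((↑) : Ω → V) '' T.support with hZ
  obtain ⟨hpn, hreg⟩ := T.isRegPt_of_mem_carrier hx₀
  have hx₀Z : x₀ ∈ Z := T.carrier_subset_image_support hx₀
  have hx₀Ω : x₀ ∈ (Ω : Set V) := T.carrier_subset hx₀
  -- a compact ball in `Ω` and a straightened chart inside it
  obtain ⟨r, hr, hrΩ⟩ := Metric.nhds_basis_closedBall.mem_iff.1 (Ω.isOpen.mem_nhds hx₀Ω)
  obtain ⟨N, g, K, π, ρ, Ψ₀, hNo, hx₀N, hNB, hg, hgZ, hsurj, hrank, hρ, hΨ, -, himage, hπ⟩ :=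
    hreg.exists_straightParam hx₀Z (ball_mem_nhds x₀ hr)
  have hKp : Module.finrank ℂ K = q + 1 := by omega
  have hNK : N ⊆ closedBall x₀ r := hNB.trans ball_subset_closedBall
  -- chart bookkeeping
  have hcarN : T.carrier ∩ N = Z ∩ N := T.carrier_inter_eq_of_chart hNo hg hgZ hsurj
  have hballZN : ∀ k ∈ ball (0 : K) ρ, Ψ₀ k ∈ Z ∩ N := fun k hk =>
    himage ▸ mem_image_of_mem Ψ₀ hk
  have himN : ∀ k ∈ ball (0 : K) ρ, Ψ₀ k ∈ N := fun k hk => (hballZN k hk).2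
  have hcarB : ∀ k ∈ ball (0 : K) ρ, Ψ₀ k ∈ T.carrier := fun k hk => by
    have h : Ψ₀ k ∈ T.carrier ∩ N := by rw [hcarN]; exact hballZN k hk
    exact h.1
  have hg0 : ∀ k ∈ ball (0 : K) ρ, g (Ψ₀ k) = 0 := fun k hk =>
    (hgZ _ (hballZN k hk).2).1 (hballZN k hk).1
  -- the density is a.e. a constant `k₀` on the chart
  obtain ⟨k₀, hk₀⟩ := T.exists_ae_density_eq_of_chart hNo hg hgZ hsurj hρ hΨ himage
    (isCompact_closedBall x₀ r) hrΩ hNK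
  have hk₀' : ∀ᵐ y ∂((μHE[2 * q + 1 + 1] : Measure V).restrict (T.carrier ∩ N)),
      T.density y = k₀ := hk₀
  -- the real structure of `K` and the derivative of `Ψ₀`
  letI iK : InnerProductSpace ℝ K := InnerProductSpace.complexToReal
  have hK2 : Module.finrank ℝ K = 2 * q + 1 + 1 := by
    have h : Module.finrank ℝ K = 2 * Module.finrank ℂ K := finrank_real_of_complex K
    omega
  set D : K → K →L[ℝ] V := fun k => (fderiv ℂ Ψ₀ k).restrictScalars ℝ with hD
  have hDat : ∀ k ∈ ball (0 : K) ρ, HasFDerivAt Ψ₀ (D k) k := fun k hk =>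
    (hΨ.differentiableAt (isOpen_ball.mem_nhds hk)).hasFDerivAt.restrictScalars ℝ
  have hDf : ∀ k ∈ ball (0 : K) ρ, HasFDerivWithinAt Ψ₀ (D k) (ball 0 ρ) k := fun k hk =>
    (hDat k hk).hasFDerivWithinAt
  have hfd : ∀ k ∈ ball (0 : K) ρ, fderiv ℝ Ψ₀ k = D k := fun k hk => (hDat k hk).fderiv
  have hDinj : ∀ k ∈ ball (0 : K) ρ, Injective (D k) := fun k hk => by
    obtain ⟨hid, -, -⟩ := SCV.straightParam_fderiv hNo hg hsurj hrank hΨ himN hg0 hπ hk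
    intro a a' haa
    have ha := congrArg (fun f : K →L[ℂ] K => f a) hid
    have hb := congrArg (fun f : K →L[ℂ] K => f a') hid
    simp only [ContinuousLinearMap.comp_apply, ContinuousLinearMap.id_apply] at ha hb
    have haa' : fderiv ℂ Ψ₀ k a = fderiv ℂ Ψ₀ k a' := haa
    rw [← ha, ← hb, haa']
  have hInjOn : InjOn Ψ₀ (ball (0 : K) ρ) := fun a ha a' ha' haa => by
    rw [← hπ a ha, ← hπ a' ha', haa]
  have hΨ₀s : ContDiffOn ℝ ∞ Ψ₀ (ball (0 : K) ρ) :=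
    (Literature.Analysis.Complex.SCV.contDiffOn_infty hΨ isOpen_ball).restrict_scalars ℝ
  -- a unitary basis `b` of `K`; its real frame `Eb`, an orthonormal basis of `K` over `ℝ`; and the
  -- linear isometry `Lc : K ≃ ℝ^{2q+2}` it defines
  set b : OrthonormalBasis (Fin (q + 1)) ℂ K := (stdOrthonormalBasis ℂ K).reindex (finCongr hKp)
    with hb
  have hon : Orthonormal ℝ (complexFrame (⇑b) : Fin (2 * q + 1 + 1) → K) :=
    orthonormal_complexFrame b.orthonormal
  have hsp : ⊤ ≤ Submodule.span ℝ (Set.range (complexFrame (⇑b) : Fin (2 * q + 1 + 1) → K)) :=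
    (hon.linearIndependent.span_eq_top_of_card_eq_finrank'
      (by rw [Fintype.card_fin, hK2]; omega)).ge
  set Eb : OrthonormalBasis (Fin (2 * q + 1 + 1)) ℝ K := OrthonormalBasis.mk hon hsp with hEb
  have hEbk : ∀ j, Eb j = complexFrame (⇑b) j := fun j => by
    rw [hEb, OrthonormalBasis.coe_mk]
  set Lc : K ≃L[ℝ] (Fin (2 * q + 1 + 1) → ℝ) :=
    Eb.repr.toContinuousLinearEquiv.trans
      (PiLp.continuousLinearEquiv 2 ℝ (fun _ : Fin (2 * q + 1 + 1) => ℝ)) with hLc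
  have hLce : ∀ j, Lc.symm (Pi.single j 1) = complexFrame (⇑b) j := fun j => by
    show Eb.repr.symm (EuclideanSpace.single j 1) = _
    rw [Eb.repr_symm_single, hEbk]
  have hLccoe : (⇑Lc : K → (Fin (2 * q + 1 + 1) → ℝ)) =
      (@WithLp.ofLp 2 (Fin (2 * q + 1 + 1) → ℝ)) ∘ ⇑Eb.repr := by
    funext k; rfl
  have hLcmp : MeasurePreserving (⇑Lc) (volume : Measure K)
      (volume : Measure (Fin (2 * q + 1 + 1) → ℝ)) := by
    rw [hLccoe]
    exact (PiLp.volume_preserving_ofLp (Fin (2 * q + 1 + 1))).comp Eb.measurePreserving_repr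
  have hLcemb : MeasurableEmbedding (⇑Lc) := Lc.toHomeomorph.measurableEmbedding
  -- the chart `Ψ = Ψ₀ ∘ Lc⁻¹` on `O₀ = Lc(B) ⊆ ℝ^{2q+2}`, its Lipschitz left inverse `ℓ`, and
  -- `G = f ∘ Ψ`
  set O₀ : Set (Fin (2 * q + 1 + 1) → ℝ) := ⇑Lc.symm ⁻¹' ball (0 : K) ρ with hO₀
  have hO₀o : IsOpen O₀ := isOpen_ball.preimage Lc.symm.continuous
  have hLcO₀ : ∀ k ∈ ball (0 : K) ρ, Lc k ∈ O₀ := fun k hk => by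
    show Lc.symm (Lc k) ∈ ball (0 : K) ρ
    rw [Lc.symm_apply_apply]; exact hk
  set Ψ : (Fin (2 * q + 1 + 1) → ℝ) → V := fun x => Ψ₀ (Lc.symm x) with hΨdef
  have hΨs : ContDiffOn ℝ ∞ Ψ O₀ := hΨ₀s.comp Lc.symm.contDiff.contDiffOn fun x hx => hx
  have hΨD : ∀ x ∈ O₀, HasFDerivAt Ψ
      ((D (Lc.symm x)).comp (Lc.symm : (Fin (2 * q + 1 + 1) → ℝ) →L[ℝ] K)) x := fun x hx =>
    (hDat (Lc.symm x) hx).comp x Lc.symm.hasFDerivAt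
  have hΨfd : ∀ x ∈ O₀, fderiv ℝ Ψ x =
      (D (Lc.symm x)).comp (Lc.symm : (Fin (2 * q + 1 + 1) → ℝ) →L[ℝ] K) := fun x hx =>
    (hΨD x hx).fderiv
  have hΨinj : ∀ x ∈ O₀, Injective (fderiv ℝ Ψ x) := fun x hx => by
    rw [hΨfd x hx]
    exact (hDinj _ hx).comp Lc.symm.injective
  set ℓ : V → (Fin (2 * q + 1 + 1) → ℝ) := fun y => Lc (π (y - x₀)) with hℓdef
  have hsub1 : LipschitzWith 1 (fun y : V => y - x₀) :=
    LipschitzWith.mk_one fun y y' => le_of_eq (by rw [dist_eq_norm, dist_eq_norm, sub_sub_sub_cancel_right])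
  have hℓ : LipschitzWith (‖(Lc : K →L[ℝ] (Fin (2 * q + 1 + 1) → ℝ))‖₊ * (‖π‖₊ * 1)) ℓ :=
    (Lc : K →L[ℝ] (Fin (2 * q + 1 + 1) → ℝ)).lipschitz.comp (π.lipschitz.comp hsub1)
  have hℓΨ : ∀ x ∈ O₀, ℓ (Ψ x) = x := fun x hx => by
    show Lc (π (Ψ₀ (Lc.symm x) - x₀)) = x
    rw [hπ _ hx, Lc.apply_symm_apply]
  have hℓΨ₀ : ∀ k ∈ ball (0 : K) ρ, ℓ (Ψ₀ k) = Lc k := fun k hk => by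
    show Lc (π (Ψ₀ k - x₀)) = Lc k
    rw [hπ k hk]
  set G : (Fin (2 * q + 1 + 1) → ℝ) → ℝ := fun x => f (Ψ x) with hGdef
  have hGs : ContDiffOn ℝ ∞ G O₀ := hf.comp_contDiffOn hΨs
  -- Sard: the critical values of `G` on `O₀` are null
  set Bad : Set ℝ := G '' {x | x ∈ O₀ ∧ ¬ Surjective (fderiv ℝ G x)} with hBad
  have hBad0 : volume Bad = 0 :=
    measure_image_setOf_not_surjective_fderiv_eq_zero volume hO₀o hGs
  refine ⟨N, hNo, hx₀N, Bad, hBad0, fun s hs x hx hfx => ?_⟩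
  -- the point `x = Ψ₀ k` of the chart and the regular level `s = G (Lc k)`
  have hx' : x ∈ Z ∩ N := by rw [← hcarN]; exact hx
  rw [← himage] at hx'
  obtain ⟨k, hk, rfl⟩ := hx'
  have hk₁ : Lc k ∈ O₀ := hLcO₀ k hk
  have hGk : G (Lc k) = s := by
    show f (Ψ₀ (Lc.symm (Lc k))) = s
    rw [Lc.symm_apply_apply]; exact hfx
  have hdG : fderiv ℝ G (Lc k) ≠ 0 := fun h0 => hs ⟨Lc k, ⟨hk₁, fun hsj => by
    obtain ⟨v, hv⟩ := hsj 1
    rw [h0] at hv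
    simp at hv⟩, hGk⟩
  -- the level-set current of the chart `Ψ` at the regular level `s` near `Lc k`
  obtain ⟨O₁, hO₁o, hkO₁, hO₁O₀, hlev⟩ :=
    exists_levelSet_chartData hO₀o hΨs hΨinj hℓ hℓΨ hGs hk₁ hdG
  obtain ⟨θ, ν, hdata, hident⟩ := hlev s
  set O : Set V := N ∩ ℓ ⁻¹' O₁ with hOdef
  have hOo : IsOpen O := hNo.inter (hO₁o.preimage hℓ.continuous)
  have hkO : Ψ₀ k ∈ O := by
    refine ⟨himN k hk, ?_⟩
    show ℓ (Ψ₀ k) ∈ O₁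
    rw [hℓΨ₀ k hk]; exact hkO₁
  -- the slice carrier near `x` is the level set of the chart
  have hMO : T.carrier ∩ f ⁻¹' {s} ∩ O = Ψ '' (O₁ ∩ G ⁻¹' {s}) := by
    apply Subset.antisymm
    · rintro y ⟨⟨hyc, hys⟩, hyN, hyO₁⟩
      have hy : y ∈ Z ∩ N := by rw [← hcarN]; exact ⟨hyc, hyN⟩
      rw [← himage] at hy
      obtain ⟨k', hk', rfl⟩ := hy
      have hk'O₁ : Lc k' ∈ O₁ := by
        have h : ℓ (Ψ₀ k') ∈ O₁ := hyO₁
        rwa [hℓΨ₀ k' hk'] at h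
      refine ⟨Lc k', ⟨hk'O₁, ?_⟩, ?_⟩
      · show f (Ψ₀ (Lc.symm (Lc k'))) ∈ ({s} : Set ℝ)
        rw [Lc.symm_apply_apply]; exact hys
      · show Ψ₀ (Lc.symm (Lc k')) = Ψ₀ k'
        rw [Lc.symm_apply_apply]
    · rintro _ ⟨x, ⟨hxO₁, hxs⟩, rfl⟩
      have hxO₀ : x ∈ O₀ := hO₁O₀ hxO₁
      refine ⟨⟨hcarB _ hxO₀, hxs⟩, himN _ hxO₀, ?_⟩
      show ℓ (Ψ x) ∈ O₁
      rw [hℓΨ x hxO₀]; exact hxO₁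
  have hΨO₁Ω : Ψ '' O₁ ⊆ (Ω : Set V) := by
    rintro _ ⟨x, hx, rfl⟩
    exact T.carrier_subset (hcarB _ (hO₁O₀ hx))
  have hdataΩ : IsRectifiableData Ω (2 * q + 1) (Ψ '' (O₁ ∩ G ⁻¹' {s})) θ ν := hdata Ω hΨO₁Ω
  refine ⟨O, hOo, hkO, fun y => k₀ * θ y, ν, ?_, fun U hU φ hφO => ?_⟩
  · rw [hMO]
    exact hdataΩ.const_mul k₀
  -- the boundary identity for `φ` supported in `O`, on `U ≤ Ω`
  -- (1) `∂[reg|T| ∩ {s<f}](φ) = ∫_{reg|T| ∩ {s<f}} θ_T dφ(ξ_T) d𝓗^{2q+2}`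
  rw [T.boundary_currentOfIntegration_inter_apply hU]
  -- (2) localise to the chart: `dφ = 0` off `spt φ ⊆ O ⊆ N`
  have hEm : MeasurableSet {y : V | s < f y} :=
    measurableSet_lt measurable_const hf.continuous.measurable
  set A : Set V := T.carrier ∩ N ∩ {y | s < f y} with hA
  have h2 : ∫ y in T.carrier ∩ {y | s < f y}, (T.density y : ℝ) * (extDeriv ⇑φ y) (T.orientationFrame y)
        ∂(μHE[2 * q + 1 + 1] : Measure V) =
      ∫ y in A, (T.density y : ℝ) * (extDeriv ⇑φ y) (T.orientationFrame y)
        ∂(μHE[2 * q + 1 + 1] : Measure V) := by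
    refine setIntegral_eq_of_subset_of_forall_sdiff_eq_zero (T.measurableSet_carrier.inter hEm)
      (fun y hy => ⟨hy.1.1, hy.2⟩) ?_
    rintro y ⟨⟨hyc, hys⟩, hyA⟩
    have hyN : y ∉ N := fun h => hyA ⟨⟨hyc, h⟩, hys⟩
    have hyφ : y ∉ tsupport ⇑φ := fun h => hyN (hφO h).1
    simp [TestForm.extDeriv_eq_zero_of_notMem_tsupport φ hyφ]
  -- (3) the density is a.e. the constant `k₀` on the chart
  have hk₀A : ∀ᵐ y ∂((μHE[2 * q + 1 + 1] : Measure V).restrict A), T.density y = k₀ :=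
    ae_restrict_of_ae_restrict_of_subset inter_subset_left hk₀'
  have h3 : ∫ y in A, (T.density y : ℝ) * (extDeriv ⇑φ y) (T.orientationFrame y)
        ∂(μHE[2 * q + 1 + 1] : Measure V) =
      (k₀ : ℝ) * ∫ y in A, (extDeriv ⇑φ y) (T.orientationFrame y)
        ∂(μHE[2 * q + 1 + 1] : Measure V) := by
    rw [← integral_const_mul]
    refine integral_congr_ae ?_
    filter_upwards [hk₀A] with y hy
    rw [hy]
  -- (4) area formula along the chart `Ψ₀ : B ∩ {s < f ∘ Ψ₀} → reg|T| ∩ N ∩ {s < f}`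
  set S' : Set K := ball (0 : K) ρ ∩ Ψ₀ ⁻¹' {y | s < f y} with hS'
  have hS'o : IsOpen S' :=
    hΨ.continuousOn.isOpen_inter_preimage isOpen_ball (isOpen_lt continuous_const hf.continuous)
  have hS'm : MeasurableSet S' := hS'o.measurableSet
  have hAS' : A = Ψ₀ '' S' := by
    rw [hA, hcarN, ← himage, hS', image_inter_preimage]
  have h4 : ∫ y in A, (extDeriv ⇑φ y) (T.orientationFrame y) ∂(μHE[2 * q + 1 + 1] : Measure V) =
      ∫ k in S', ((D k : K →L[ℝ] V) : K →ₗ[ℝ] V).normDet •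
        (extDeriv ⇑φ (Ψ₀ k)) (T.orientationFrame (Ψ₀ k)) := by
    rw [hAS']
    have hAF := integral_image_eq_integral_normDet_smul (V := V) hS'm
      (fun k hk => (hDf k hk.1).mono inter_subset_left) (fun k hk => hDinj k hk.1)
      (hInjOn.mono inter_subset_left) (fun y => (extDeriv ⇑φ y) (T.orientationFrame y))
    rw [hK2] at hAF
    simpa only using hAF
  -- (5) the canonical orientation: `J(DΨ₀) dφ(ξ_T ∘ Ψ₀) = (Ψ₀^* dφ)(e)`, `e` the real frame of `b`
  have hpt : ∀ k ∈ S',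
      ((D k : K →L[ℝ] V) : K →ₗ[ℝ] V).normDet • (extDeriv ⇑φ (Ψ₀ k)) (T.orientationFrame (Ψ₀ k)) =
        ((extDeriv ⇑φ (Ψ₀ k)).compContinuousLinearMap (fderiv ℝ Ψ₀ k)) (complexFrame ⇑b) := by
    intro k hk
    obtain ⟨u, hu, hspan, hξ⟩ := T.exists_orientationFrame_eq_complexFrame_of_chart hNo hg hgZ
      hsurj hrank hKp hΨ himage hπ hk.1
    have hspan' : ((Submodule.span ℝ (Set.range (complexFrame u)) : Submodule ℝ V) : Set V) =
        Set.range ⇑(fderiv ℂ Ψ₀ k) := hspan.trans (LinearMap.coe_range _)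
    have hR5 := apply_comp_complexFrame_eq_normDet_mul (p := q + 1) b (fderiv ℂ Ψ₀ k) hu hspan'
      (extDeriv ⇑φ (Ψ₀ k))
    rw [ContinuousAlternatingMap.compContinuousLinearMap_apply, hfd k hk.1, hξ, smul_eq_mul]
    exact hR5.symm
  have h5 : ∫ k in S', ((D k : K →L[ℝ] V) : K →ₗ[ℝ] V).normDet •
        (extDeriv ⇑φ (Ψ₀ k)) (T.orientationFrame (Ψ₀ k)) =
      ∫ k in S', ((extDeriv ⇑φ (Ψ₀ k)).compContinuousLinearMap (fderiv ℝ Ψ₀ k)) (complexFrame ⇑b) :=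
    setIntegral_congr_fun hS'm hpt
  -- (6) transport to `ℝ^{2q+2}` by the isometry `Lc`
  set H : (Fin (2 * q + 1 + 1) → ℝ) → ℝ := fun x =>
    ((extDeriv ⇑φ (Ψ x)).compContinuousLinearMap (fderiv ℝ Ψ x)) (fun j => Pi.single j 1) with hH
  have hHLc : ∀ k ∈ S', H (Lc k) =
      ((extDeriv ⇑φ (Ψ₀ k)).compContinuousLinearMap (fderiv ℝ Ψ₀ k)) (complexFrame ⇑b) := by
    intro k hk
    have hΨk : Ψ (Lc k) = Ψ₀ k := by
      show Ψ₀ (Lc.symm (Lc k)) = Ψ₀ k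
      rw [Lc.symm_apply_apply]
    show ((extDeriv ⇑φ (Ψ (Lc k))).compContinuousLinearMap (fderiv ℝ Ψ (Lc k)))
        (fun j => Pi.single j 1) = _
    rw [hΨfd _ (hLcO₀ k hk.1), Lc.symm_apply_apply, hΨk,
      ContinuousAlternatingMap.compContinuousLinearMap_apply,
      ContinuousAlternatingMap.compContinuousLinearMap_apply, hfd k hk.1]
    congr 1
    funext j
    show D k (Lc.symm (Pi.single j 1)) = D k (complexFrame (⇑b) j)
    rw [hLce j]
  have hLcS' : Lc '' S' = O₀ ∩ {x | s < G x} := by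
    rw [ContinuousLinearEquiv.image_eq_preimage_symm]
    exact Set.ext fun x => Iff.rfl
  have h6 : ∫ k in S', ((extDeriv ⇑φ (Ψ₀ k)).compContinuousLinearMap (fderiv ℝ Ψ₀ k)) (complexFrame ⇑b) =
      ∫ x in O₀ ∩ {x | s < G x}, H x := by
    rw [← setIntegral_congr_fun hS'm hHLc, ← hLcS']
    exact (hLcmp.setIntegral_image_emb hLcemb H S').symm
  -- (7) shrink to `O₁`: `dφ ∘ Ψ = 0` on `O₀ ∖ O₁`, as `spt φ ⊆ O = N ∩ ℓ⁻¹(O₁)` and `ℓ ∘ Ψ = id`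
  have hGo : IsOpen (O₀ ∩ {x | s < G x}) :=
    hGs.continuousOn.isOpen_inter_preimage hO₀o (isOpen_lt continuous_const continuous_id)
  have h7 : ∫ x in O₀ ∩ {x | s < G x}, H x = ∫ x in O₁ ∩ {x | s < G x}, H x := by
    refine setIntegral_eq_of_subset_of_forall_sdiff_eq_zero hGo.measurableSet
      (inter_subset_inter_left _ hO₁O₀) ?_
    rintro x ⟨⟨hxO₀, hxs⟩, hx1⟩
    have hxO₁ : x ∉ O₁ := fun h => hx1 ⟨h, hxs⟩
    have hΨx : Ψ x ∉ tsupport ⇑φ := fun h => hxO₁ (by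
      have h' : ℓ (Ψ x) ∈ O₁ := (hφO h).2
      rwa [hℓΨ x hxO₀] at h')
    show ((extDeriv ⇑φ (Ψ x)).compContinuousLinearMap (fderiv ℝ Ψ x)) (fun j => Pi.single j 1) = 0
    rw [ContinuousAlternatingMap.compContinuousLinearMap_apply,
      TestForm.extDeriv_eq_zero_of_notMem_tsupport φ hΨx]
    rfl
  -- (8) the level-set current of the chart
  set C : Set (Fin (2 * q + 1 + 1) → ℝ) := ℓ '' tsupport ⇑φ with hC
  have hCc : IsCompact C := φ.hasCompactSupport.isCompact.image hℓ.continuous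
  have hCO₁ : C ⊆ O₁ := by
    rintro _ ⟨y, hy, rfl⟩
    exact (hφO hy).2
  have hvan : ∀ x ∈ O₀, x ∉ C → ⇑φ (Ψ x) = 0 := fun x hx hxC => by
    by_contra hne
    exact hxC ⟨Ψ x, subset_tsupport _ (Function.mem_support.2 hne), hℓΨ x hx⟩
  have h8 : ∫ x in O₁ ∩ {x | s < G x}, H x =
      currentOfIntegration (Ψ '' (O₁ ∩ G ⁻¹' {s})) θ ν φ := hident U φ C hCc hCO₁ hvan
  -- (9) assemble, scaling the density by `k₀`
  have hθU : LocallyIntegrableOn (fun y => (θ y : ℝ) • frameVector (ν y)) (U : Set V)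
      ((μHE[2 * q + 1] : Measure V).restrict (Ψ '' (O₁ ∩ G ⁻¹' {s}))) :=
    hdataΩ.2.2.2.1.mono_set (show (U : Set V) ⊆ Ω from hU)
  rw [h2, h3, h4, h5, h6, h7, h8, hMO, currentOfIntegration_const_mul_apply hθU]

/-- **Level slices of a holomorphic chain, almost every level.** For a holomorphic `(q+1)`-chain
`T` on `Ω` and a smooth `f : V → ℝ`: for Lebesgue-almost every level `s`, EVERY point
`x ∈ reg|T|` with `f x = s` has an open neighbourhood `O` carrying admissible rectifiable data
`(reg|T| ∩ f⁻¹{s} ∩ O, θ, ν)` on `Ω` with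
`∂[reg|T| ∩ {s < f}, θ_T, ξ_T](φ) = [reg|T| ∩ f⁻¹{s} ∩ O, θ, ν](φ)` for all test forms `φ`
supported in `O`, on every open `U ≤ Ω` (countably many of the chart neighbourhoods of
`exists_nhds_sliceData` cover `reg|T|` — Lindelöf — and the union of their bad level sets is null).
[cite: Federer1969, 4.3.8; Harvey1977, Lemma 1.8 (proof, p. 320)] -/
theorem ae_forall_exists_sliceData {q : ℕ} (T : HolomorphicChain 𝓘(ℂ, V) Ω (q + 1)) {f : V → ℝ}
    (hf : ContDiff ℝ ∞ f) :
    letI : InnerProductSpace ℝ V := InnerProductSpace.complexToReal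
    ∀ᵐ s : ℝ, ∀ x ∈ T.carrier, f x = s →
      ∃ O : Set V, IsOpen O ∧ x ∈ O ∧ ∃ (θ : V → ℤ) (ν : V → Fin (2 * q + 1) → V),
        IsRectifiableData Ω (2 * q + 1) (T.carrier ∩ f ⁻¹' {s} ∩ O) θ ν ∧
        ∀ U : Opens V, U ≤ Ω → ∀ φ : TestForm U (2 * q + 1), tsupport ⇑φ ⊆ O →
          (currentOfIntegration (T.carrier ∩ {y | s < f y}) T.density
              (T.orientationFrame : V → Fin (2 * q + 1 + 1) → V) :
                Current U (2 * q + 1 + 1)).boundary φ =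
            currentOfIntegration (T.carrier ∩ f ⁻¹' {s} ∩ O) θ ν φ := by
  classical
  letI iV : InnerProductSpace ℝ V := InnerProductSpace.complexToReal
  haveI : ProperSpace V := FiniteDimensional.proper ℂ V
  choose! N hNo hxN Bad hBad hgood using
    fun x (hx : x ∈ T.carrier) => T.exists_nhds_sliceData hf hx
  -- countably many chart neighbourhoods cover the carrier (Lindelöf)
  have hcov : ∀ x ∈ T.carrier, N x ∈ 𝓝[T.carrier] x := fun x hx =>
    mem_nhdsWithin_of_mem_nhds ((hNo x hx).mem_nhds (hxN x hx))
  obtain ⟨t, htc, htcount, hcover⟩ := TopologicalSpace.countable_cover_nhdsWithin hcov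
  have hnull : volume (⋃ x ∈ t, Bad x) = 0 :=
    (measure_biUnion_null_iff htcount).2 fun x hx => hBad x (htc hx)
  filter_upwards [measure_eq_zero_iff_ae_notMem.1 hnull] with s hs x hx hfx
  obtain ⟨x', hx't, hxN'⟩ := mem_iUnion₂.1 (hcover hx)
  have hs' : s ∉ Bad x' := fun h => hs (mem_iUnion₂.2 ⟨x', hx't, h⟩)
  exact hgood x' (htc hx't) s hs' x ⟨hx, hxN'⟩ hfx

end HolomorphicChain

end Literature.Geometry.Kaehler
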